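import Mathlib
import HarnessLib.Audit
import Summits.PneNP.PneNP.Theorems.PstarForcing
import Summits.PneNP.PneNP.Theorems.PstarChordBridgeFlat
import Summits.PneNP.PneNP.Theorems.PstarChordBridgeCorner

/-!
# One GATED chord, CASE P with units: LOCALITY — constraint forms that vanish on `Z(q)` read only the variables of `q` (E2 node N2X; prover-1 g21)

FRONTIER range-avoidance ladder, rung F-N3 (`stmt-PneNP-19007`), cell `pnp-ideate` (`PstarGateNodesX.GateCasePUnitsX`); restricted-model proof
complexity — nothing here bears on `P` versus `NP`.

In CASE P the second constraint form `q = q_{(1,0)}` is state-free, (T3) puts every other chord ON on `Z = Z(q)` and pins the first constraint's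
form there (`g' := q_{(0,1)} + ℓ + const ≡ 0` on `Z`).  The point of this file: such a `g'` cannot read any variable that `q` does not read.

* MODEL `shift_invariant_of_forcing` — `q` quadratic of rank `≥ 4`, `g` quadratic with `Z(q) ⊆ Z(g)`, `q` invariant under the translation `v`
  ⟹ `g` invariant under `v` (the affine `x ↦ g(x+v) + g(x)` has `{· = 1} ⊆ {q = 1}`, so `PstarForcing.not_forced_of_affine` makes it `0`);
* `bilin_eq_zero_of_single` — a bilinear form vanishing against `y` on all basis vectors vanishes against `y`;
  `qform_shift_of_avoid` — `Q_D` is `e_v`-invariant when no output of `D` holds `v`;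
* `qDir_shift_invariant` — **`q_{(1,0)}` is `e_v`-invariant** as soon as its polar form vanishes at `(e_w, e_v)` for all `w`, the containment
  `Z(q) ⊆ {Q_D = c}` holds for a family `D ≠ ∅` avoiding `v` (the constant `q(e_v) + q(0)` is `0`: otherwise `Z(q)` meets every pair
  `{x, x + e_v}`, forcing `Q_D ≡ c`, while `Q_D(0) = 0 ≠ 1 = Q_D(e_a + e_b)` on an AND pair of `D`);
* `gfun_shift_invariant` — **then `q_{(0,1)} + ℓ` is `e_v`-invariant too** (`ℓ` affine and `e_v`-invariant, `Z(q) ⊆ Z(q_{(0,1)} + ℓ + c₁)`,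
  rank `q ≥ 4`); `reads_of_shift_invariant` — an `e_v`-invariant `q_m` has `q_m(e_v) = q_m(0)` and `polarDir m (e_w, e_v) = 0` for all `w`
  (the inputs of the read criteria of `PstarGateCasePUnitsTouch`).
-/

set_option linter.dupNamespace false -- `Summit.PneNP.PneNP.…`: summit = sub-problem name (D-0017 single-conjunct layout)

open Finset Module Literature.Computability.Complexity
open Summit.PneNP.PneNP.Theorems.PstarCubeIdeals (IsAffineFn isAffineFn_of_linear)
open Summit.PneNP.PneNP.Theorems.PstarQuadRank (rad)
open Summit.PneNP.PneNP.Theorems.PstarProductRank (qform polar)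
open Summit.PneNP.PneNP.Theorems.PstarPathRank (AndAdj polar_basis)
open Summit.PneNP.PneNP.Theorems.PstarForcing (not_forced_of_affine)
open Summit.PneNP.PneNP.Theorems.PstarReadSumset (V2)
open Summit.PneNP.PneNP.Theorems.PstarChordBridge (BridgeData)
open Summit.PneNP.PneNP.Theorems.PstarChordBridgeForcing (qform_add')
open Summit.PneNP.PneNP.Theorems.PstarChordBridgeBasis (qDir polarDir)
open Summit.PneNP.PneNP.Theorems.PstarChordBridgeCorner (qDir_add andAdj_iff_mem)
open Summit.PneNP.PneNP.Theorems.PstarChordBridgeFlat (qform_zero qform_single qform_pair)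

namespace Summit.PneNP.PneNP.Theorems.PstarGateCasePUnitsLocal

/-- Every element of `𝔽₂` is `0` or `1`. -/
private theorem z01 (t : ZMod 2) : t = 0 ∨ t = 1 := by
  revert t; decide

/-! ## Model: forcing transports translation invariance -/

section Model

variable {M : Type*} [AddCommGroup M] [Module (ZMod 2) M] [Fintype M]

/-- **MODEL: locality by forcing.**  `q` quadratic of rank `≥ 4`, `g` quadratic vanishing on `Z(q)`, `q` invariant under translation by `v`
⟹ `g` invariant under translation by `v`. -/
theorem shift_invariant_of_forcing {q g : M → ZMod 2} {B B' : LinearMap.BilinForm (ZMod 2) M}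
    (hq : ∀ x w, q (x + w) = q x + q w + q 0 + B x w) (hrank : finrank (ZMod 2) (rad B) + 4 ≤ finrank (ZMod 2) M)
    (hg : ∀ x w, g (x + w) = g x + g w + g 0 + B' x w) (hZ : ∀ x, q x = 0 → g x = 0) {v : M} (hv : ∀ x, q (x + v) = q x) :
    ∀ x, g (x + v) = g x := by
  -- the affine difference `h x = g (x + v) + g x + 1`
  have hdiff : ∀ x, g (x + v) + g x + 1 = LinearMap.flip B' v x + (g v + g 0 + 1) := by
    intro x
    rw [hg x v, LinearMap.flip_apply]
    generalize g x = a; generalize g v = b; generalize g 0 = c; generalize B' x v = d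
    revert a b c d; decide
  have haff : IsAffineFn (fun x => g (x + v) + g x + 1) := by
    have h := isAffineFn_of_linear (LinearMap.flip B' v) (g v + g 0 + 1)
    intro x w
    show g (x + w + v) + g (x + w) + 1 = (g (x + v) + g x + 1) + (g (w + v) + g w + 1) + (g (0 + v) + g 0 + 1)
    rw [hdiff, hdiff, hdiff, hdiff]
    exact h x w
  have hZ' : ∀ x, g (x + v) + g x + 1 = 0 → q x = 1 := by
    intro x hx
    rcases z01 (q x) with h0 | h1
    · exfalso
      have h1' := hZ x h0
      have h2' := hZ (x + v) (by rw [hv]; exact h0)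
      rw [h1', h2'] at hx
      exact absurd hx (by decide)
    · exact h1
  have hall := not_forced_of_affine haff hq hrank hZ'
  intro x
  have h := hall x
  have e2 : ∀ a b : ZMod 2, a + b + 1 = 1 → a = b := by decide
  exact e2 _ _ h

end Model

/-! ## Instance: translation invariance of AND-sums and of `q_m` -/

variable {n m : ℕ}

/-- A bilinear form vanishing against `y` on every basis vector vanishes against `y`. -/
theorem bilin_eq_zero_of_single {Bf : LinearMap.BilinForm (ZMod 2) (Fin n → ZMod 2)} {y : Fin n → ZMod 2}
    (h : ∀ w, Bf (Pi.single w (1 : ZMod 2)) y = 0) : ∀ x, Bf x y = 0 := by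
  have hflip : LinearMap.flip Bf y = 0 := by
    refine LinearMap.pi_ext fun w a => ?_
    rw [LinearMap.flip_apply, LinearMap.zero_apply]
    rcases z01 a with rfl | rfl
    · rw [Pi.single_zero, map_zero, LinearMap.zero_apply]
    · exact h w
  intro x
  have := LinearMap.congr_fun hflip x
  rwa [LinearMap.flip_apply, LinearMap.zero_apply] at this

/-- **An AND-sum is `e_v`-invariant when no output holds `v`.** -/
theorem qform_shift_of_avoid (I : LocalMap 4 n m) (hI : I.IsPure xorAndPred) (hS : PstarSALevel.SimpleOverlap I) (D : Finset (Fin m)) {v : Fin n}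
    (hv : ∀ j ∈ D, I.vars j 2 ≠ v ∧ I.vars j 3 ≠ v) (x : Fin n → ZMod 2) :
    qform D (fun j => I.vars j 2) (fun j => I.vars j 3) (x + Pi.single v (1 : ZMod 2)) = qform D (fun j => I.vars j 2) (fun j => I.vars j 3) x := by
  have hpol : ∀ w, polar D (fun j => I.vars j 2) (fun j => I.vars j 3) (Pi.single w (1 : ZMod 2)) (Pi.single v (1 : ZMod 2)) = 0 := by
    intro w
    rw [polar_basis I hI hS, if_neg]
    rintro ⟨j, hj, ⟨-, h3⟩ | ⟨h2, -⟩⟩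
    · exact (hv j hj).2 h3
    · exact (hv j hj).1 h2
  rw [qform_add' I D, qform_single I hI, qform_zero, bilin_eq_zero_of_single hpol x]
  simp only [add_zero]

/-- **`q_m` is `e_v`-invariant**: polar form vanishing at `(·, e_v)`, the containment `Z(q_m) ⊆ {Q_D = c}` for a non-empty family `D`
avoiding `v`. -/
theorem qDir_shift_invariant (I : LocalMap 4 n m) (hI : I.IsPure xorAndPred) (hS : PstarSALevel.SimpleOverlap I) (B : BridgeData n m) (mv : V2)
    {D : Finset (Fin m)} {c : ZMod 2} {v : Fin n}
    (hP : ∀ x, qDir I B mv x = 0 → qform D (fun j => I.vars j 2) (fun j => I.vars j 3) x = c)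
    (hpol : ∀ w, polarDir I B mv (Pi.single w (1 : ZMod 2)) (Pi.single v (1 : ZMod 2)) = 0)
    (hv : ∀ j ∈ D, I.vars j 2 ≠ v ∧ I.vars j 3 ≠ v) (hD : D.Nonempty) :
    ∀ x, qDir I B mv (x + Pi.single v (1 : ZMod 2)) = qDir I B mv x := by
  set e : Fin n → ZMod 2 := Pi.single v 1 with he
  -- the difference is the constant `q(e_v) + q(0)`
  have hdiff : ∀ x, qDir I B mv (x + e) = qDir I B mv x + (qDir I B mv e + qDir I B mv 0) := by
    intro x
    rw [qDir_add, bilin_eq_zero_of_single hpol x, add_zero, add_assoc]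
  -- which is `0`
  rcases z01 (qDir I B mv e + qDir I B mv 0) with h0 | h1
  · intro x; rw [hdiff, h0, add_zero]
  · exfalso
    -- every pair `{x, x + e}` meets `Z(q)`, so `Q_D ≡ c`
    have hall : ∀ x, qform D (fun j => I.vars j 2) (fun j => I.vars j 3) x = c := by
      intro x
      rcases z01 (qDir I B mv x) with hx | hx
      · exact hP x hx
      · have hx' : qDir I B mv (x + e) = 0 := by rw [hdiff, hx, h1]; decide
        rw [← qform_shift_of_avoid I hI hS D hv x]
        exact hP _ hx'
    obtain ⟨j, hj⟩ := hD
    have h0' := hall 0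
    rw [qform_zero] at h0'
    have h1' := hall ((Pi.single (I.vars j 2) (1 : ZMod 2) : Fin n → ZMod 2) + Pi.single (I.vars j 3) 1)
    rw [qform_pair I hI hS, if_pos ((andAdj_iff_mem I hI hS D j).2 hj)] at h1'
    rw [← h0'] at h1'
    exact one_ne_zero h1'

/-- **Then `q_{(0,1)}` is `e_v`-invariant** whenever `q_{(0,1)} + ℓ + c₁` (with `ℓ` affine, `e_v`-invariant) vanishes on `Z(q_{(1,0)})` and
`q_{(1,0)}` has rank `≥ 4` and is `e_v`-invariant. -/
theorem gfun_shift_invariant (I : LocalMap 4 n m) (B : BridgeData n m) {ℓ : (Fin n → ZMod 2) → ZMod 2} (hℓ : IsAffineFn ℓ) {c₁ : ZMod 2}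
    (hrank : finrank (ZMod 2) (rad (polarDir I B (1, 0))) + 4 ≤ finrank (ZMod 2) (Fin n → ZMod 2))
    (hP3 : ∀ x, qDir I B (1, 0) x = 0 → qDir I B (0, 1) x + ℓ x + c₁ = 0) {v : Fin n → ZMod 2}
    (hqv : ∀ x, qDir I B (1, 0) (x + v) = qDir I B (1, 0) x) (hℓv : ∀ x, ℓ (x + v) = ℓ x) :
    ∀ x, qDir I B (0, 1) (x + v) = qDir I B (0, 1) x := by
  have hg : ∀ x w, (qDir I B (0, 1) (x + w) + ℓ (x + w) + c₁) =
      (qDir I B (0, 1) x + ℓ x + c₁) + (qDir I B (0, 1) w + ℓ w + c₁) + (qDir I B (0, 1) 0 + ℓ 0 + c₁) + polarDir I B (0, 1) x w := by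
    intro x w
    rw [qDir_add, hℓ x w]
    generalize qDir I B (0, 1) x = a; generalize qDir I B (0, 1) w = a'; generalize qDir I B (0, 1) 0 = a₀
    generalize ℓ x = b; generalize ℓ w = b'; generalize ℓ 0 = b₀; generalize polarDir I B (0, 1) x w = d; generalize c₁ = k
    revert a a' a₀ b b' b₀ d k; decide
  have h := shift_invariant_of_forcing (q := qDir I B (1, 0)) (g := fun x => qDir I B (0, 1) x + ℓ x + c₁) (qDir_add I B (1, 0)) hrank hg hP3 hqv
  intro x
  have hx : qDir I B (0, 1) (x + v) + ℓ (x + v) + c₁ = qDir I B (0, 1) x + ℓ x + c₁ := h x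
  rw [hℓv x] at hx
  have e3 : ∀ a a' b k : ZMod 2, a + b + k = a' + b + k → a = a' := by decide
  exact e3 _ _ _ _ hx

/-- **Reads of an `e_v`-invariant `q_m`**: the linear coefficient `q_m(e_v) + q_m(0)` vanishes and so does `polarDir m (e_w, e_v)` for all `w`. -/
theorem reads_of_shift_invariant (I : LocalMap 4 n m) (B : BridgeData n m) (mv : V2) {v : Fin n}
    (h : ∀ x, qDir I B mv (x + Pi.single v (1 : ZMod 2)) = qDir I B mv x) :
    qDir I B mv (Pi.single v 1) = qDir I B mv 0 ∧ ∀ w, polarDir I B mv (Pi.single w (1 : ZMod 2)) (Pi.single v (1 : ZMod 2)) = 0 := by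
  have h0 : qDir I B mv (Pi.single v 1) = qDir I B mv 0 := by
    have := h 0; rwa [zero_add] at this
  refine ⟨h0, fun w => ?_⟩
  have h1 := qDir_add I B mv (Pi.single w 1) (Pi.single v 1)
  rw [h (Pi.single w 1), h0] at h1
  generalize qDir I B mv (Pi.single w 1) = a at h1; generalize qDir I B mv 0 = b at h1
  generalize polarDir I B mv (Pi.single w 1) (Pi.single v 1) = d at h1
  revert a b d; decide

end Summit.PneNP.PneNP.Theorems.PstarGateCasePUnitsLocal
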